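import Literature.Analysis.FluidPDE.LerayHopfTranslateTorus
import Literature.Analysis.FluidPDE.TimeAverageEnstrophy
import HarnessLib

/-!
# Restarting a forced Leray–Hopf solution on the flat torus at almost every time

Analysis/FluidPDE support file (all proved). Torus twin, for a STEADY smooth force `g`, of
`IsLerayHopfOn.ae_isLerayHopfOn_restart` (`Literature.Analysis.FluidPDE.LerayHopfRestart`,
Euclidean space, unforced). For a global Leray–Hopf weak solution `u` of the Navier–Stokes
equations on `T^d` with viscosity `ν ≥ 0`, steady smooth force `g` and datum `u₀`
(`Torus.IsGlobalLerayHopf ν (fun _ => g) u₀ u`):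

* `IsGlobalLerayHopf.isGlobalLerayHopf_translate` — if the energy inequality holds from the time
  `s > 0` (on every horizon), then the translate `u(· + s)` is a global Leray–Hopf weak solution
  with force `g` from the datum `u(s)`: the weak formulation is
  `IsLerayHopfOn.isWeakNSSolutionForcedOn_translate` (`LerayHopfTranslateTorus`, cut-off argument
  of Robinson–Rodrigo–Sadowski 2016, §3.1), fed with the strong right-continuity in `L²` at `s`
  (`IsLerayHopfOn.tendsto_eLpNorm_sub_nhdsGT_of_le_add`: the work of the force `∫ₛᵗ⟨g, u⟩`
  tends to zero); the `L^∞L²`, `L²H¹` clauses and the energy inequalities from `0` (= from `s`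
  for `u`) and from a.e. `s'` are those of `u`, translated (`ae_restrict_Ioo_comp_add_right`,
  `setLIntegral_Ioo_comp_add_right`, `intervalIntegral.integral_comp_add_right`); weak `L²`
  continuity on `(0, T]` and the weak limit at `0⁺` come from weak continuity of `u` at the
  interior time `s`;
* `IsGlobalLerayHopf.ae_energy_ineq_from` — the energy inequality holds from a.e. `s > 0` on
  every horizon (countable intersection over integer horizons of the field `energy_ineq_ae`);
* `IsGlobalLerayHopf.ae_isGlobalLerayHopf_translate`, `…exists_isGlobalLerayHopf_translate` —
  the translate is global Leray–Hopf from `u(s)` for a.e. `s > 0`, in particular for some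
  `s > 0` at which moreover `‖∇u(s)‖₂ < ∞` (the slices are in `H¹` for a.e. time).

This is the (folklore) restarting remark of Robinson–Rodrigo–Sadowski 2016, Def. 4.9 and p. 131
("we can find a sequence of initial conditions `u_{0,n} = u(t_n) ∈ V` … such that the energy
inequality holds from time `t_n`"), Leray 1934, §III (5.1)–(5.2), in the forced periodic setting
of Foias–Manley–Rosa–Temam 2001, Ch. II (7.20).

## References

* J. C. Robinson, J. L. Rodrigo, W. Sadowski, *The three-dimensional Navier–Stokes equations*
  (CUP 2016), Def. 3.3, Def. 4.9, Cor. 4.8, p. 131. [RobinsonRodrigoSadowski2016]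
* J. Leray, Acta Math. 63 (1934), §III (5.1)–(5.2). [Leray1934]
* C. Foias, O. Manley, R. Rosa, R. Temam, *Navier–Stokes Equations and Turbulence*, CUP 2001,
  Ch. II §7 (7.20). [FoiasManleyRosaTemam2001]
-/

noncomputable section

open MeasureTheory TopologicalSpace Set Function Filter Topology InnerProductSpace
open scoped RealInnerProductSpace ENNReal NNReal

namespace Literature.Analysis.FluidPDE.Torus

variable {d : Type*} [Fintype d] [DecidableEq d]

variable {ν : ℝ} {g : UnitAddTorus d → EuclideanSpace ℝ d} {f : ℝ → UnitAddTorus d → EuclideanSpace ℝ d}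
  {u : ℝ → UnitAddTorus d → EuclideanSpace ℝ d} {u₀ : UnitAddTorus d → EuclideanSpace ℝ d}

/-- The shift `t ↦ t + s` maps `𝓝[>] 0` to `𝓝[>] s`. [folklore] -/
theorem tendsto_add_right_nhdsGT_zero (s : ℝ) :
    Tendsto (fun t : ℝ => t + s) (𝓝[>] (0 : ℝ)) (𝓝[>] s) := by
  have h2 : Tendsto (fun t : ℝ => t + s) (𝓝 0) (𝓝 (0 + s)) :=
    (continuous_id.add continuous_const).tendsto 0
  rw [zero_add] at h2
  refine tendsto_nhdsWithin_iff.2 ⟨h2.mono_left nhdsWithin_le_nhds, ?_⟩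
  filter_upwards [self_mem_nhdsWithin] with t ht
  exact show s < t + s by linarith [mem_Ioi.1 ht]

/-- **Strong right-continuity at a time from which the energy inequality holds** (forced,
steady smooth force): if `u` is Leray–Hopf on `T^d × [0, T)` with force `g` and the energy
inequality holds from `s ∈ (0, T)`, then `‖u(τ) - u(s)‖_{L²} → 0` as `τ → s⁺` — the work
`∫ₛᵗ⟨g, u⟩` of the force tends to zero (continuity of the primitive of an integrable function),
so `IsLerayHopfOn.tendsto_eLpNorm_sub_nhdsGT_of_le_add` applies (Robinson–Rodrigo–Sadowski 2016,
Cor. 4.8). [cite: RobinsonRodrigoSadowski2016, Cor. 4.8 (with Lemma A.20)] -/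
theorem IsLerayHopfOn.tendsto_eLpNorm_sub_nhdsGT_of_energy_ineq {T : ℝ}
    (hLH : IsLerayHopfOn T ν (fun _ => g) u₀ u) (hg : FunctionSpaces.Torus.IsSmooth g) (hν : 0 ≤ ν)
    {s : ℝ} (hs : s ∈ Ioo 0 T)
    (hEs : ∀ t ∈ Icc s T, FunctionSpaces.Torus.kineticEnergy (u t) +
      ν * (∫⁻ τ in Ioo s t, FunctionSpaces.Torus.eGradNormSq (u τ)).toReal ≤
        FunctionSpaces.Torus.kineticEnergy (u s) + ∫ τ in s..t, ∫ x, ⟪g x, u τ x⟫) :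
    Tendsto (fun τ => eLpNorm (u τ - u s) 2 volume) (𝓝[>] s) (𝓝 0) := by
  set W : ℝ → ℝ := fun τ => ∫ x, ⟪g x, u τ x⟫ with hW
  -- the work is integrable on `(0, T)`
  have hWi : IntegrableOn W (Ioo 0 T) := by
    have h := hLH.integrableOn_integral_inner hg.continuous
    refine h.congr_fun (fun τ _ => ?_) measurableSet_Ioo
    exact integral_congr_ae (ae_of_all _ fun x => real_inner_comm _ _)
  -- its primitive from `s` tends to zero at `s⁺`
  have hR : Tendsto (fun t => ∫ τ in s..t, W τ) (𝓝[>] s) (𝓝 0) := by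
    have hWi' : IntervalIntegrable W volume s T :=
      (intervalIntegrable_iff_integrableOn_Ioo_of_le hs.2.le).2
        (hWi.mono_set (Ioo_subset_Ioo_left hs.1.le))
    have hc := intervalIntegral.continuousOn_primitive_interval' hWi' left_mem_uIcc
    have hcs : ContinuousWithinAt (fun b => ∫ x in s..b, W x) (uIcc s T) s := hc s left_mem_uIcc
    rw [ContinuousWithinAt, intervalIntegral.integral_same, uIcc_of_le hs.2.le] at hcs
    exact hcs.mono_left (nhdsWithin_le_iff.2 (mem_of_superset (Ioo_mem_nhdsGT hs.2) Ioo_subset_Icc_self))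
  refine hLH.tendsto_eLpNorm_sub_nhdsGT_of_le_add hs hR fun t ht => ?_
  have h1 := hEs t ht
  have h2 : 0 ≤ ν * (∫⁻ τ in Ioo s t, FunctionSpaces.Torus.eGradNormSq (u τ)).toReal :=
    mul_nonneg hν ENNReal.toReal_nonneg
  linarith

/-- **The translate of a global Leray–Hopf solution at a time from which the energy
inequality holds is a global Leray–Hopf solution** (steady smooth force, `ν ≥ 0`). If `u` is
a global Leray–Hopf weak solution on `T^d` with force `g`, `s > 0`, and for every `t ≥ s`
`½‖u(t)‖² + ν∫ₛᵗ‖∇u‖₂² ≤ ½‖u(s)‖² + ∫ₛᵗ⟨g, u⟩` (the energy inequality from `s`, true for a.e.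
`s`, `ae_energy_ineq_from`), then `u(· + s)` is a global Leray–Hopf weak solution with force `g`
from the datum `u(s)`: the weak formulation is `IsLerayHopfOn.isWeakNSSolutionForcedOn_translate`
(strong right-continuity at `s` from the energy inequality); the `L^∞L²` and `L²H¹` clauses
and the energy inequalities from `0` and from a.e. `s'` are those of `u`, translated; weak `L²`
continuity and the weak limit at `0⁺` come from weak continuity of `u` at the interior time `s`
(Robinson–Rodrigo–Sadowski 2016, Def. 4.9 and p. 131; Leray 1934, §III (5.1)–(5.2)). [cite: RobinsonRodrigoSadowski2016, Def. 4.9 and p. 131 (proof of Thm. 8.17)] -/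
theorem IsGlobalLerayHopf.isGlobalLerayHopf_translate (hg : FunctionSpaces.Torus.IsSmooth g)
    (hν : 0 ≤ ν) (hu : IsGlobalLerayHopf ν (fun _ => g) u₀ u) {s : ℝ} (hs : 0 < s)
    (hEs : ∀ t, s ≤ t → FunctionSpaces.Torus.kineticEnergy (u t) +
      ν * (∫⁻ τ in Ioo s t, FunctionSpaces.Torus.eGradNormSq (u τ)).toReal ≤
        FunctionSpaces.Torus.kineticEnergy (u s) + ∫ τ in s..t, ∫ x, ⟪g x, u τ x⟫) :
    IsGlobalLerayHopf ν (fun _ => g) (u s) (fun t => u (t + s)) := by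
  -- strong right-continuity at `s`
  have h0 : Tendsto (fun τ => eLpNorm (u τ - u s) 2 volume) (𝓝[>] s) (𝓝 0) :=
    (hu (s + 1) (by linarith)).tendsto_eLpNorm_sub_nhdsGT_of_energy_ineq hg hν ⟨hs, by linarith⟩
      fun t ht => hEs t ht.1
  have hsh : Tendsto (fun t : ℝ => t + s) (𝓝[>] (0 : ℝ)) (𝓝 s) :=
    (tendsto_add_right_nhdsGT_zero s).mono_right nhdsWithin_le_nhds
  intro T hT
  have hLH := hu (T + s) (by linarith)
  have hsub : Ioo (0 + s) (T + s) ⊆ Ioo 0 (T + s) := fun t ht => ⟨by linarith [ht.1], ht.2⟩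
  have hμ : volume.restrict (Ioo (0 + s) (T + s)) ≤ volume.restrict (Ioo 0 (T + s)) :=
    Measure.restrict_mono hsub le_rfl
  obtain ⟨C, hC⟩ := hLH.energy_bound
  obtain ⟨hS1, hS2⟩ := hLH.memL2Sobolev
  set D : ℝ → ℝ≥0∞ := fun τ => FunctionSpaces.Torus.eGradNormSq (u τ) with hD
  refine
    { weak := hLH.isWeakNSSolutionForcedOn_translate hg hs hT h0
      energy_bound := ⟨C, ae_restrict_Ioo_comp_add_right s (ae_mono hμ hC)⟩
      memLp := fun t ht => hLH.memLp (t + s) ⟨by linarith [ht.1], by linarith [ht.2]⟩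
      memL2Sobolev := ⟨ae_restrict_Ioo_comp_add_right s (ae_mono hμ hS1), ?_⟩
      energy_ineq_zero := fun t ht => ?_
      energy_ineq_ae := ?_
      weak_continuous := fun w hw => ?_
      strong_initial := h0.comp (tendsto_add_right_nhdsGT_zero s) }
  · -- `u(· + s) ∈ L²(0, T; H¹)`
    unfold FunctionSpaces.Torus.eL2SobolevNorm at hS2 ⊢
    have hle : ∫⁻ t in Ioo 0 T, FunctionSpaces.Torus.eSobolevNorm 1
        (FunctionSpaces.EuclideanSpace.complexify ∘ u (t + s)) ^ 2 ≤
        ∫⁻ t in Ioo 0 (T + s), FunctionSpaces.Torus.eSobolevNorm 1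
          (FunctionSpaces.EuclideanSpace.complexify ∘ u t) ^ 2 := by
      rw [setLIntegral_Ioo_comp_add_right (fun t => FunctionSpaces.Torus.eSobolevNorm 1
        (FunctionSpaces.EuclideanSpace.complexify ∘ u t) ^ 2) 0 T s]
      exact lintegral_mono_set hsub
    exact lt_of_le_of_lt (ENNReal.rpow_le_rpow hle (by norm_num)) hS2
  · -- energy inequality from `0` (= from `s` for `u`)
    have h1 := hEs (t + s) (by linarith [ht.1])
    have h2 := intervalIntegral.integral_comp_add_right (a := (0 : ℝ)) (b := t)
      (fun τ => ∫ x, ⟪g x, u τ x⟫) s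
    rw [zero_add] at h2
    show FunctionSpaces.Torus.kineticEnergy (u (t + s)) +
        ν * (∫⁻ τ in Ioo 0 t, D (τ + s)).toReal ≤
      FunctionSpaces.Torus.kineticEnergy (u s) + ∫ τ in (0 : ℝ)..t, (fun τ => ∫ x, ⟪g x, u τ x⟫) (τ + s)
    rw [setLIntegral_Ioo_comp_add_right D 0 t s, zero_add, h2]
    exact h1
  · -- energy inequality from a.e. `s'`
    have h1 := ae_restrict_Ioo_comp_add_right s (ae_mono hμ hLH.energy_ineq_ae)
    filter_upwards [h1] with s' hs' t ht
    have h2 := intervalIntegral.integral_comp_add_right (a := s') (b := t)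
      (fun τ => ∫ x, ⟪g x, u τ x⟫) s
    show FunctionSpaces.Torus.kineticEnergy (u (t + s)) +
        ν * (∫⁻ τ in Ioo s' t, D (τ + s)).toReal ≤
      FunctionSpaces.Torus.kineticEnergy (u (s' + s)) +
        ∫ τ in s'..t, (fun τ => ∫ x, ⟪g x, u τ x⟫) (τ + s)
    rw [setLIntegral_Ioo_comp_add_right D s' t s, h2]
    exact hs' (t + s) ⟨by linarith [ht.1], by linarith [ht.2]⟩
  · -- weak `L²` continuity on `(0, T]` and the weak limit at `0⁺`
    obtain ⟨hco, -⟩ := hLH.weak_continuous w hw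
    refine ⟨hco.comp (continuousOn_id.add continuousOn_const) fun t ht =>
      ⟨by linarith [ht.1], by linarith [ht.2]⟩, ?_⟩
    exact (hco.continuousAt (Ioc_mem_nhds hs (by linarith))).tendsto.comp hsh

/-- **The energy inequality holds from almost every time, on every horizon.** For a global
Leray–Hopf weak solution on `T^d` (any force), for a.e. `s > 0` and every `t ≥ s`:
`½‖u(t)‖² + ν∫ₛᵗ‖∇u‖₂² ≤ ½‖u(s)‖² + ∫ₛᵗ∫⟪f, u⟫` (countable intersection over the integer
horizons `n + 1` of the field `energy_ineq_ae`; Foias–Manley–Rosa–Temam 2001, Ch. II (7.20)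
"for almost all `t₀`"). [cite: FoiasManleyRosaTemam2001, Ch. II Thm. 7.3–7.4, (7.16)–(7.17)] -/
theorem IsGlobalLerayHopf.ae_energy_ineq_from (hu : IsGlobalLerayHopf ν f u₀ u) :
    ∀ᵐ s ∂volume, 0 < s → ∀ t, s ≤ t → FunctionSpaces.Torus.kineticEnergy (u t) +
      ν * (∫⁻ τ in Ioo s t, FunctionSpaces.Torus.eGradNormSq (u τ)).toReal ≤
        FunctionSpaces.Torus.kineticEnergy (u s) + ∫ τ in s..t, ∫ x, ⟪f τ x, u τ x⟫ := by
  have hn : ∀ n : ℕ, ∀ᵐ s ∂volume, s ∈ Ioo (0 : ℝ) (n + 1) → ∀ t ∈ Icc s ((n : ℝ) + 1),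
      FunctionSpaces.Torus.kineticEnergy (u t) +
        ν * (∫⁻ τ in Ioo s t, FunctionSpaces.Torus.eGradNormSq (u τ)).toReal ≤
          FunctionSpaces.Torus.kineticEnergy (u s) + ∫ τ in s..t, ∫ x, ⟪f τ x, u τ x⟫ :=
    fun n => (ae_restrict_iff' measurableSet_Ioo).1 (hu ((n : ℝ) + 1) (by positivity)).energy_ineq_ae
  rw [← ae_all_iff] at hn
  filter_upwards [hn] with s hs hs0 t hst
  obtain ⟨n, hn⟩ := exists_nat_gt t
  exact hs n ⟨hs0, by linarith⟩ t ⟨hst, by linarith⟩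

/-- **Restarting at almost every time** (steady smooth force, `ν ≥ 0`): for a global
Leray–Hopf weak solution `u` on `T^d` with force `g`, for a.e. `s > 0` the translate
`u(· + s)` is a global Leray–Hopf weak solution with force `g` from the datum `u(s)`
(`isGlobalLerayHopf_translate` at the good times of `ae_energy_ineq_from`; Robinson–Rodrigo–
Sadowski 2016, Def. 4.9 and p. 131). [cite: RobinsonRodrigoSadowski2016, Def. 4.9 and p. 131 (proof of Thm. 8.17)] -/
theorem IsGlobalLerayHopf.ae_isGlobalLerayHopf_translate (hg : FunctionSpaces.Torus.IsSmooth g)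
    (hν : 0 ≤ ν) (hu : IsGlobalLerayHopf ν (fun _ => g) u₀ u) :
    ∀ᵐ s ∂volume, 0 < s → IsGlobalLerayHopf ν (fun _ => g) (u s) (fun t => u (t + s)) := by
  filter_upwards [hu.ae_energy_ineq_from] with s hs hs0
  exact hu.isGlobalLerayHopf_translate hg hν hs0 (hs hs0)

/-- **A good restarting time with finite enstrophy.** For a global Leray–Hopf weak solution
`u` on `T^d` with steady smooth force `g` and `ν ≥ 0` there is `s > 0` such that
`‖∇u(s)‖₂ < ∞` (the slices lie in `H¹` for a.e. time, `IsGlobalLerayHopf.ae_eGradNormSq_lt_top`)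
and `u(· + s)` is a global Leray–Hopf weak solution with force `g` from `u(s)` — the step
"`u_{0,n} = u(t_n) ∈ V` … such that the energy inequality holds from time `t_n`" of
Robinson–Rodrigo–Sadowski 2016, p. 131. [cite: RobinsonRodrigoSadowski2016, Def. 4.9 and p. 131 (proof of Thm. 8.17)] -/
theorem IsGlobalLerayHopf.exists_isGlobalLerayHopf_translate (hg : FunctionSpaces.Torus.IsSmooth g)
    (hν : 0 ≤ ν) (hu : IsGlobalLerayHopf ν (fun _ => g) u₀ u) :
    ∃ s : ℝ, 0 < s ∧ FunctionSpaces.Torus.eGradNormSq (u s) < ⊤ ∧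
      IsGlobalLerayHopf ν (fun _ => g) (u s) (fun t => u (t + s)) := by
  have h1 := hu.ae_isGlobalLerayHopf_translate hg hν
  have h2 := hu.ae_eGradNormSq_lt_top
  have h : ∀ᵐ s ∂(volume.restrict (Ioo (0 : ℝ) 1)), FunctionSpaces.Torus.eGradNormSq (u s) < ⊤ ∧
      IsGlobalLerayHopf ν (fun _ => g) (u s) (fun t => u (t + s)) := by
    filter_upwards [ae_restrict_of_ae h1, ae_restrict_of_ae h2, ae_restrict_mem measurableSet_Ioo]
      with s hs1 hs2 hs
    exact ⟨hs2 hs.1, hs1 hs.1⟩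
  obtain ⟨s, hs, hP⟩ := exists_mem_Ioo_of_ae_Ioo one_pos le_rfl h
  exact ⟨s, hs.1, hP.1, hP.2⟩

end Literature.Analysis.FluidPDE.Torus

end
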